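import Literature.RepresentationTheory.HeisenbergGroup.QuasiInvariantFunctionalSiegelTransport
import HarnessLib

/-!
# Eigenvectors transported onto Siegel unipotents and Levi dilations: the VECTOR twin of
# `QuasiInvariantFunctionalSiegelTransport`

Topic `RepresentationTheory/HeisenbergGroup`; namespace `Literature.RepresentationTheory.HeisenbergGroup`.  THEOREMS ONLY
(no definition, no named fact, no `sorry`).  Sequel of `MetaplecticImplementerConjugation` /
`QuasiInvariantFunctionalSiegelTransport` ([MoeglinVignerasWaldspurger1987, Chap. 2 II.1 (A), II.6], [Weil1964, n° 13]):
those files transport a quasi-invariant FUNCTIONAL `Λ` (`Λ ∘ U = κ Λ`) through a conjugation `g₀ g g₀⁻¹ = n(b)` inside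
`S̃p_ψ(W)`; this file does the same for a VECTOR.  For a model `ρ` with implementers unique up to scalar (`hU`), a pair
`q = (g₀, M₀) ∈ S̃p_ψ`, an element `p = (g, U) ∈ S̃p_ψ` and a vector `f` with `U f = κ f`:

* §1 (any model) `MpPsi.exists_eigenvector_conj_eq_smul` — if `N` implements `g₀ g g₀⁻¹` then `M₀ U M₀⁻¹ = c N`, hence
  **`N (M₀ f) = (c⁻¹ κ) · M₀ f`**: the transported vector `M₀ f = op(q) f` is an eigenvector of `N`
  (`MpPsi.exists_eigenvector_conj_eq_smul_toOp`: the same with `N = op(n)`, `π(n) = g₀ g g₀⁻¹`).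
* §2 (the Schrödinger model `ρ = schrodingerSB β ψ` on `𝒮(X)`)
  (V1) `eigenvector_of_conj_unipotentSp` — `g₀ g g₀⁻¹ = n(b)` a Siegel unipotent: `M₀ f` is an eigenvector of the
  multiplication operator `unipotentEquivSB ψ (½β(·, b·))`, pointwise (`…_apply`)
  `(M₀ f)(x) · ψ(−½β(x, b x)) = κ′ · (M₀ f)(x)`;
  (V2) `eigenvector_of_conj_weyl_unipotentSp` — `g₀ g g₀⁻¹ = w n(b) w⁻¹` with `w` IMPLEMENTED by an automorphism `ℱ` of
  `𝒮(X)` (`Implements ρ (ofSymplectic w) ℱ`, e.g. a partial Fourier transform): the same for `ℱ⁻¹ (M₀ f)`;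
  (V3) `eigenvector_of_conj_levi` — `g₀ g g₀⁻¹ = m(a, d)` a Siegel Levi element: `M₀ f` is an eigenvector of the dilation
  `leviEquivSB a`, pointwise `(M₀ f)(a⁻¹ x) = κ′ · (M₀ f)(x)`.
* §3 (coordinates `X = R^ι`, a splitting `e : ι₁ ⊕ ι₂ ≃ ι`, a symmetric `c₀ : X →ₗ Y` supported on the `ι₁`-block — the
  context of `eigen_family_of_conj_unipotentSp`) the FAMILY forms for a root subgroup `t ↦ p t` with `f` an eigenvector of
  every `op(p t)`: with `Q ξ := −½ β(ξ ⊔ 0, c₀ (ξ ⊔ 0))`,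
  (V1′) `eigenvector_family_of_conj_unipotentSp`: `∀ t, ∃ κ, ∀ x, (M₀ f)(x) · ψ(t · Q(x|ι₁)) = κ · (M₀ f)(x)`;
  (V2′) `eigenvector_family_of_conj_weyl_unipotentSp`: the same for `ℱ⁻¹ (M₀ f)`;
  (V3′) `eigenvector_family_of_conj_levi`: a family of Levi conjugates, `(M₀ f)((a t)⁻¹ x) = κ_t · (M₀ f)(x)`.

Use (cell hodgecm-mathlib, ROAD δ of the NSI closer, file δ2 `UnitaryGroupOddLineNoIntegralEigenvector`): `ρ` the local
Schrödinger model, `f` a common eigenvector of the implementers of `ι_v(K)`, `q` the Darboux mover, `p t` the root subgroups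
`ι_v(n_{bδ}(r))`, `ι_v(n_{bδ}(r″))` and the torus `ι_v(m_t)`; the outputs are the support / eigen hypotheses of the integral
uncertainty principle (file δ1).  Nothing about unitary groups is in this file.

## References
* [MoeglinVignerasWaldspurger1987] C. Mœglin, M.-F. Vignéras, J.-L. Waldspurger, *Correspondances de Howe sur un corps
  p-adique*, LNM 1291 (1987), Chap. 2 II.1 (A), II.6.
* [Weil1964] A. Weil, *Sur certains groupes d'opérateurs unitaires*, Acta Math. 111 (1964), n° 13, p. 160.
-/

set_option autoImplicit false

noncomputable section

namespace Literature.RepresentationTheory.HeisenbergGroup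

open Literature.NumberTheory.Automorphic

/-! ## §1 Any model with implementers unique up to scalar: conjugation transports eigenvectors -/

section Generic

variable {R : Type*} [CommRing R] [Invertible (2 : R)] {V : Type*} [AddCommGroup V] [Module R V]
  {B : V →ₗ[R] V →ₗ[R] R}
variable {k : Type*} [CommRing k] {S : Type*} [AddCommGroup S] [Module k S]
variable (ρ : Representation k (Heisenberg B) S)

/-- **Transport of an eigenvector through a conjugation.**  If `U f = κ f` (`p = (g, U) ∈ S̃p_ψ`) and `N` implements
`g₀ g g₀⁻¹` (`q = (g₀, M₀)`), then `M₀ f` is an eigenvector of `N`: `N (M₀ f) = (c κ) · M₀ f` for a unit `c`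
(namely the inverse of the scalar of `M₀ U M₀⁻¹ = c N`). [cite: MoeglinVignerasWaldspurger1987, Chap. 2 II.1 (A)] -/
theorem MpPsi.exists_eigenvector_conj_eq_smul (hU : ImplementerUniqueUpToScalar ρ) (q p : MpPsi ρ) {N : S ≃ₗ[k] S}
    (hN : Implements ρ (ofSymplectic B (MpPsi.proj ρ q * MpPsi.proj ρ p * (MpPsi.proj ρ q)⁻¹)) N)
    (f : S) (κ : k) (hf : MpPsi.toOp ρ p f = κ • f) :
    ∃ c : kˣ, N (MpPsi.toOp ρ q f) = ((c : k) * κ) • MpPsi.toOp ρ q f := by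
  obtain ⟨c, hc⟩ := MpPsi.exists_conj_toOp_eq_smul ρ hU q p hN
  refine ⟨c⁻¹, ?_⟩
  have h1 := hc (MpPsi.toOp ρ q f)
  rw [LinearEquiv.symm_apply_apply, hf, map_smul] at h1
  calc N (MpPsi.toOp ρ q f)
      = ((c⁻¹ : kˣ) : k) • ((c : k) • N (MpPsi.toOp ρ q f)) := by rw [smul_smul, Units.inv_mul, one_smul]
    _ = ((c⁻¹ : kˣ) : k) • (κ • MpPsi.toOp ρ q f) := by rw [← h1]
    _ = (((c⁻¹ : kˣ) : k) * κ) • MpPsi.toOp ρ q f := by rw [smul_smul]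

/-- **Transport of an eigenvector inside `S̃p_ψ(W)`**: if `U f = κ f` and `π(q) π(p) π(q)⁻¹ = π(n)` then
`op(n) (M₀ f) = (c κ) · M₀ f`, `c` a unit. [cite: MoeglinVignerasWaldspurger1987, Chap. 2 II.1 (A)] -/
theorem MpPsi.exists_eigenvector_conj_eq_smul_toOp (hU : ImplementerUniqueUpToScalar ρ) (q p n : MpPsi ρ)
    (h : MpPsi.proj ρ q * MpPsi.proj ρ p * (MpPsi.proj ρ q)⁻¹ = MpPsi.proj ρ n)
    (f : S) (κ : k) (hf : MpPsi.toOp ρ p f = κ • f) :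
    ∃ c : kˣ, MpPsi.toOp ρ n (MpPsi.toOp ρ q f) = ((c : k) * κ) • MpPsi.toOp ρ q f :=
  MpPsi.exists_eigenvector_conj_eq_smul ρ hU q p (N := MpPsi.toOp ρ n) (by rw [h]; exact (mem_MpPsi ρ _).1 n.2) f κ hf

end Generic

/-! ## §2 The Schrödinger model: Siegel unipotents, Weyl-conjugated unipotents, Levi dilations -/

section Schrodinger

variable {R : Type*} [CommRing R] [Invertible (2 : R)] {X Y : Type*} [AddCommGroup X] [Module R X] [AddCommGroup Y]
  [Module R Y] (β : X →ₗ[R] Y →ₗ[R] R) (ψ : AddChar R Circle)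
variable [TopologicalSpace X] [TopologicalSpace R] [IsTopologicalAddGroup X] [ContinuousNeg R]
  (hψ : IsLocallyConstant (⇑ψ : R → Circle)) (hβ : ∀ y : Y, Continuous fun u : X => β u y)

/-- **(V1) an eigenvector transported onto a Siegel unipotent is an eigenvector of the second-degree character**
(operator form): `g₀ g g₀⁻¹ = n(b)`, `U f = κ f` ⇒ `ψ(−½β(·, b·)) · (M₀ f) = (c κ) · M₀ f`.
[cite: MoeglinVignerasWaldspurger1987, Chap. 2 II.1 (A), II.6] [cite: Weil1964, n° 13, p. 160] -/
theorem eigenvector_of_conj_unipotentSp (hU : ImplementerUniqueUpToScalar (schrodingerSB β ψ hψ hβ))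
    (q p : MpPsi (schrodingerSB β ψ hψ hβ)) (b : X →ₗ[R] Y) (hb : ∀ x x', β x (b x') = β x' (b x))
    (hq : Continuous fun x : X => ⅟(2 : R) * β x (b x))
    (h : MpPsi.proj _ q * MpPsi.proj _ p * (MpPsi.proj _ q)⁻¹ = unipotentSp β b hb)
    (f : SchwartzBruhat X) (κ : ℂ) (hf : MpPsi.toOp _ p f = κ • f) :
    ∃ c : ℂˣ, unipotentEquivSB ψ hψ (fun x : X => ⅟(2 : R) * β x (b x)) hq (MpPsi.toOp _ q f) =
      ((c : ℂ) * κ) • MpPsi.toOp _ q f := by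
  have hN := unipotent_mem_MpPsi β ψ hψ hβ b hb hq
  rw [mem_MpPsi] at hN
  exact MpPsi.exists_eigenvector_conj_eq_smul _ hU q p
    (N := unipotentEquivSB ψ hψ (fun x : X => ⅟(2 : R) * β x (b x)) hq) (by rw [h]; exact hN) f κ hf

/-- **(V1) pointwise**: `(M₀ f)(x) · ψ(−½β(x, b x)) = κ′ · (M₀ f)(x)` for all `x`.
[cite: MoeglinVignerasWaldspurger1987, Chap. 2 II.1 (A), II.6] [cite: Weil1964, n° 13, p. 160] -/
theorem eigenvector_of_conj_unipotentSp_apply (hU : ImplementerUniqueUpToScalar (schrodingerSB β ψ hψ hβ))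
    (q p : MpPsi (schrodingerSB β ψ hψ hβ)) (b : X →ₗ[R] Y) (hb : ∀ x x', β x (b x') = β x' (b x))
    (hq : Continuous fun x : X => ⅟(2 : R) * β x (b x))
    (h : MpPsi.proj _ q * MpPsi.proj _ p * (MpPsi.proj _ q)⁻¹ = unipotentSp β b hb)
    (f : SchwartzBruhat X) (κ : ℂ) (hf : MpPsi.toOp _ p f = κ • f) :
    ∃ κ' : ℂ, ∀ x : X,
      ((MpPsi.toOp _ q f : SchwartzBruhat X) : X → ℂ) x * ((ψ (-(⅟(2 : R) * β x (b x))) : Circle) : ℂ) =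
        κ' * ((MpPsi.toOp _ q f : SchwartzBruhat X) : X → ℂ) x := by
  obtain ⟨c, hc⟩ := eigenvector_of_conj_unipotentSp β ψ hψ hβ hU q p b hb hq h f κ hf
  refine ⟨(c : ℂ) * κ, fun x => ?_⟩
  have := congrArg (fun g : SchwartzBruhat X => (g : X → ℂ) x) hc
  simp only [coe_unipotentEquivSB, unipotentOp_apply, Submodule.coe_smul, Pi.smul_apply, smul_eq_mul] at this
  rw [mul_comm, this]

/-- **(V2) conjugates landing on `w n(b) w⁻¹` with `w` implemented by `ℱ`** (operator form): `ℱ ∘ (ψ(−½β(·,b·))·) ∘ ℱ⁻¹`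
implements `g₀ g g₀⁻¹`, hence `ψ(−½β(·, b·)) · ℱ⁻¹(M₀ f) = (c κ) · ℱ⁻¹(M₀ f)` when `U f = κ f`.
[cite: MoeglinVignerasWaldspurger1987, Chap. 2 II.1 (A), II.6] [cite: Weil1964, n° 13, p. 160] -/
theorem eigenvector_of_conj_weyl_unipotentSp (hU : ImplementerUniqueUpToScalar (schrodingerSB β ψ hψ hβ))
    (q p : MpPsi (schrodingerSB β ψ hψ hβ)) (w : symplecticGroup (polar β))
    (ℱ : SchwartzBruhat X ≃ₗ[ℂ] SchwartzBruhat X) (hwF : Implements (schrodingerSB β ψ hψ hβ) (ofSymplectic (polar β) w) ℱ)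
    (b : X →ₗ[R] Y) (hb : ∀ x x', β x (b x') = β x' (b x)) (hq : Continuous fun x : X => ⅟(2 : R) * β x (b x))
    (h : MpPsi.proj _ q * MpPsi.proj _ p * (MpPsi.proj _ q)⁻¹ = w * unipotentSp β b hb * w⁻¹)
    (f : SchwartzBruhat X) (κ : ℂ) (hf : MpPsi.toOp _ p f = κ • f) :
    ∃ c : ℂˣ, unipotentEquivSB ψ hψ (fun x : X => ⅟(2 : R) * β x (b x)) hq (ℱ.symm (MpPsi.toOp _ q f)) =
      ((c : ℂ) * κ) • ℱ.symm (MpPsi.toOp _ q f) := by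
  have hN := unipotent_mem_MpPsi β ψ hψ hβ b hb hq
  rw [mem_MpPsi] at hN
  have hI : Implements (schrodingerSB β ψ hψ hβ)
      (ofSymplectic (polar β) (MpPsi.proj _ q * MpPsi.proj _ p * (MpPsi.proj _ q)⁻¹))
      (ℱ * unipotentEquivSB ψ hψ (fun x : X => ⅟(2 : R) * β x (b x)) hq * ℱ⁻¹) := by
    rw [h, map_mul, map_mul, map_inv]
    exact Implements.mul _ (Implements.mul _ hwF hN) (Implements.inv _ hwF)
  obtain ⟨c, hc⟩ := MpPsi.exists_eigenvector_conj_eq_smul _ hU q p hI f κ hf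
  refine ⟨c, ?_⟩
  rw [LinearEquiv.mul_apply, LinearEquiv.mul_apply, LinearEquiv.coe_inv] at hc
  have h2 := congrArg ℱ.symm hc
  rw [LinearEquiv.symm_apply_apply, map_smul] at h2
  exact h2

/-- **(V2) pointwise**: `(ℱ⁻¹(M₀ f))(x) · ψ(−½β(x, b x)) = κ′ · (ℱ⁻¹(M₀ f))(x)` for all `x`.
[cite: MoeglinVignerasWaldspurger1987, Chap. 2 II.1 (A), II.6] [cite: Weil1964, n° 13, p. 160] -/
theorem eigenvector_of_conj_weyl_unipotentSp_apply (hU : ImplementerUniqueUpToScalar (schrodingerSB β ψ hψ hβ))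
    (q p : MpPsi (schrodingerSB β ψ hψ hβ)) (w : symplecticGroup (polar β))
    (ℱ : SchwartzBruhat X ≃ₗ[ℂ] SchwartzBruhat X) (hwF : Implements (schrodingerSB β ψ hψ hβ) (ofSymplectic (polar β) w) ℱ)
    (b : X →ₗ[R] Y) (hb : ∀ x x', β x (b x') = β x' (b x)) (hq : Continuous fun x : X => ⅟(2 : R) * β x (b x))
    (h : MpPsi.proj _ q * MpPsi.proj _ p * (MpPsi.proj _ q)⁻¹ = w * unipotentSp β b hb * w⁻¹)
    (f : SchwartzBruhat X) (κ : ℂ) (hf : MpPsi.toOp _ p f = κ • f) :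
    ∃ κ' : ℂ, ∀ x : X,
      ((ℱ.symm (MpPsi.toOp _ q f) : SchwartzBruhat X) : X → ℂ) x * ((ψ (-(⅟(2 : R) * β x (b x))) : Circle) : ℂ) =
        κ' * ((ℱ.symm (MpPsi.toOp _ q f) : SchwartzBruhat X) : X → ℂ) x := by
  obtain ⟨c, hc⟩ := eigenvector_of_conj_weyl_unipotentSp β ψ hψ hβ hU q p w ℱ hwF b hb hq h f κ hf
  refine ⟨(c : ℂ) * κ, fun x => ?_⟩
  have := congrArg (fun g : SchwartzBruhat X => (g : X → ℂ) x) hc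
  simp only [coe_unipotentEquivSB, unipotentOp_apply, Submodule.coe_smul, Pi.smul_apply, smul_eq_mul] at this
  rw [mul_comm, this]

omit [ContinuousNeg R] in
/-- **(V3) an eigenvector transported onto a Siegel Levi element is an eigenvector of the dilation** (operator form):
`g₀ g g₀⁻¹ = m(a, d)`, `U f = κ f` ⇒ `(M₀ f) ∘ a⁻¹ = (c κ) · M₀ f` (`leviEquivSB a` implements `m(a, d)`,
`levi_mem_MpPsi`). [cite: MoeglinVignerasWaldspurger1987, Chap. 2 II.1 (A), II.6] [cite: Weil1964, n° 13, p. 160] -/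
theorem eigenvector_of_conj_levi (hU : ImplementerUniqueUpToScalar (schrodingerSB β ψ hψ hβ))
    (q p : MpPsi (schrodingerSB β ψ hψ hβ)) (a : X ≃ₗ[R] X) (d : Y ≃ₗ[R] Y) (had : ∀ x y, β (a x) (d y) = β x y)
    (ha : Continuous a) (ha' : Continuous a.symm)
    (h : MpPsi.proj _ q * MpPsi.proj _ p * (MpPsi.proj _ q)⁻¹ = leviSp β a d had)
    (f : SchwartzBruhat X) (κ : ℂ) (hf : MpPsi.toOp _ p f = κ • f) :
    ∃ c : ℂˣ, leviEquivSB a ha ha' (MpPsi.toOp _ q f) = ((c : ℂ) * κ) • MpPsi.toOp _ q f := by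
  have hN := levi_mem_MpPsi β ψ hψ hβ a d had ha ha'
  rw [mem_MpPsi] at hN
  exact MpPsi.exists_eigenvector_conj_eq_smul _ hU q p (N := leviEquivSB a ha ha') (by rw [h]; exact hN) f κ hf

omit [ContinuousNeg R] in
/-- **(V3) pointwise**: `(M₀ f)(a⁻¹ x) = κ′ · (M₀ f)(x)` for all `x`.
[cite: MoeglinVignerasWaldspurger1987, Chap. 2 II.1 (A), II.6] [cite: Weil1964, n° 13, p. 160] -/
theorem eigenvector_of_conj_levi_apply (hU : ImplementerUniqueUpToScalar (schrodingerSB β ψ hψ hβ))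
    (q p : MpPsi (schrodingerSB β ψ hψ hβ)) (a : X ≃ₗ[R] X) (d : Y ≃ₗ[R] Y) (had : ∀ x y, β (a x) (d y) = β x y)
    (ha : Continuous a) (ha' : Continuous a.symm)
    (h : MpPsi.proj _ q * MpPsi.proj _ p * (MpPsi.proj _ q)⁻¹ = leviSp β a d had)
    (f : SchwartzBruhat X) (κ : ℂ) (hf : MpPsi.toOp _ p f = κ • f) :
    ∃ κ' : ℂ, ∀ x : X,
      ((MpPsi.toOp _ q f : SchwartzBruhat X) : X → ℂ) (a.symm x) =
        κ' * ((MpPsi.toOp _ q f : SchwartzBruhat X) : X → ℂ) x := by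
  obtain ⟨c, hc⟩ := eigenvector_of_conj_levi β ψ hψ hβ hU q p a d had ha ha' h f κ hf
  refine ⟨(c : ℂ) * κ, fun x => ?_⟩
  have := congrArg (fun g : SchwartzBruhat X => (g : X → ℂ) x) hc
  simp only [coe_leviEquivSB, leviOp_apply, Submodule.coe_smul, Pi.smul_apply, smul_eq_mul] at this
  exact this

end Schrodinger

/-! ## §3 Coordinates: root families conjugated onto `n(t • c₀)`, `w n(t • c₀) w⁻¹`, and Levi families -/

section Coordinates

variable {R : Type*} [CommRing R] [Invertible (2 : R)] [TopologicalSpace R] [IsTopologicalRing R]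
  {ι ι₁ ι₂ : Type*} (e : ι₁ ⊕ ι₂ ≃ ι)
  {Y : Type*} [AddCommGroup Y] [Module R Y] (β : (ι → R) →ₗ[R] Y →ₗ[R] R) (ψ : AddChar R Circle)
  (hψ : IsLocallyConstant (⇑ψ : R → Circle)) (hβ : ∀ y : Y, Continuous fun u : (ι → R) => β u y)
  (c₀ : (ι → R) →ₗ[R] Y) (hc₀ : ∀ x x', β x (c₀ x') = β x' (c₀ x))
  (hsupp : ∀ x : ι → R, β x (c₀ x) = β (glue e (resL e x) 0) (c₀ (glue e (resL e x) 0)))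
  (hq : ∀ t : R, Continuous fun x : ι → R => ⅟(2 : R) * β x ((t • c₀) x))

include hc₀ hsupp hq in
/-- **(V1′) a common eigenvector of a root family conjugated onto Siegel unipotents.**  If
`g₀ · π(p t) · g₀⁻¹ = n(t • c₀)` for all `t` and `f` is an eigenvector of every `op(p t)`, then `M₀ f = op(q) f` satisfies,
with `Q ξ := −½ β(ξ ⊔ 0, c₀ (ξ ⊔ 0))`: `∀ t, ∃ κ, ∀ x, (M₀ f)(x) · ψ(t · Q(x|ι₁)) = κ · (M₀ f)(x)`.
[cite: MoeglinVignerasWaldspurger1987, Chap. 2 II.1 (A), II.6] [cite: Weil1964, n° 13, p. 160] -/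
theorem eigenvector_family_of_conj_unipotentSp (hU : ImplementerUniqueUpToScalar (schrodingerSB β ψ hψ hβ))
    (q : MpPsi (schrodingerSB β ψ hψ hβ)) (p : R → MpPsi (schrodingerSB β ψ hψ hβ))
    (h : ∀ t : R, MpPsi.proj _ q * MpPsi.proj _ (p t) * (MpPsi.proj _ q)⁻¹ =
      unipotentSp β (t • c₀) (symm_smul_of_symm β c₀ hc₀ t))
    (f : SchwartzBruhat (ι → R)) (hf : ∀ t : R, ∃ κ : ℂ, MpPsi.toOp _ (p t) f = κ • f) (t : R) :
    ∃ κ : ℂ, ∀ x : ι → R,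
      ((MpPsi.toOp _ q f : SchwartzBruhat (ι → R)) : (ι → R) → ℂ) x *
          ((ψ (t * -(⅟(2 : R) * β (glue e (resL e x) 0) (c₀ (glue e (resL e x) 0)))) : Circle) : ℂ) =
        κ * ((MpPsi.toOp _ q f : SchwartzBruhat (ι → R)) : (ι → R) → ℂ) x := by
  obtain ⟨κ, hκ⟩ := hf t
  obtain ⟨κ', hκ'⟩ := eigenvector_of_conj_unipotentSp_apply β ψ hψ hβ hU q (p t) (t • c₀)
    (symm_smul_of_symm β c₀ hc₀ t) (hq t) (h t) f κ hκ
  refine ⟨κ', fun x => ?_⟩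
  rw [← neg_half_smul_eq_mul_resL e β c₀ hsupp, hκ' x]

include hc₀ hsupp hq in
/-- **(V2′) a common eigenvector of a root family conjugated onto `w n(t • c₀) w⁻¹`, `w` implemented by `ℱ`.**
With `Q ξ := −½ β(ξ ⊔ 0, c₀ (ξ ⊔ 0))`: `∀ t, ∃ κ, ∀ x, (ℱ⁻¹(M₀ f))(x) · ψ(t · Q(x|ι₁)) = κ · (ℱ⁻¹(M₀ f))(x)`.
[cite: MoeglinVignerasWaldspurger1987, Chap. 2 II.1 (A), II.6] [cite: Weil1964, n° 13, p. 160] -/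
theorem eigenvector_family_of_conj_weyl_unipotentSp (hU : ImplementerUniqueUpToScalar (schrodingerSB β ψ hψ hβ))
    (q : MpPsi (schrodingerSB β ψ hψ hβ)) (p : R → MpPsi (schrodingerSB β ψ hψ hβ)) (w : symplecticGroup (polar β))
    (ℱ : SchwartzBruhat (ι → R) ≃ₗ[ℂ] SchwartzBruhat (ι → R))
    (hwF : Implements (schrodingerSB β ψ hψ hβ) (ofSymplectic (polar β) w) ℱ)
    (h : ∀ t : R, MpPsi.proj _ q * MpPsi.proj _ (p t) * (MpPsi.proj _ q)⁻¹ =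
      w * unipotentSp β (t • c₀) (symm_smul_of_symm β c₀ hc₀ t) * w⁻¹)
    (f : SchwartzBruhat (ι → R)) (hf : ∀ t : R, ∃ κ : ℂ, MpPsi.toOp _ (p t) f = κ • f) (t : R) :
    ∃ κ : ℂ, ∀ x : ι → R,
      ((ℱ.symm (MpPsi.toOp _ q f) : SchwartzBruhat (ι → R)) : (ι → R) → ℂ) x *
          ((ψ (t * -(⅟(2 : R) * β (glue e (resL e x) 0) (c₀ (glue e (resL e x) 0)))) : Circle) : ℂ) =
        κ * ((ℱ.symm (MpPsi.toOp _ q f) : SchwartzBruhat (ι → R)) : (ι → R) → ℂ) x := by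
  obtain ⟨κ, hκ⟩ := hf t
  obtain ⟨κ', hκ'⟩ := eigenvector_of_conj_weyl_unipotentSp_apply β ψ hψ hβ hU q (p t) w ℱ hwF (t • c₀)
    (symm_smul_of_symm β c₀ hc₀ t) (hq t) (h t) f κ hκ
  refine ⟨κ', fun x => ?_⟩
  rw [← neg_half_smul_eq_mul_resL e β c₀ hsupp, hκ' x]

end Coordinates

section LeviFamily

variable {R : Type*} [CommRing R] [Invertible (2 : R)] {X Y : Type*} [AddCommGroup X] [Module R X] [AddCommGroup Y]
  [Module R Y] (β : X →ₗ[R] Y →ₗ[R] R) (ψ : AddChar R Circle)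
variable [TopologicalSpace X] [TopologicalSpace R] [IsTopologicalAddGroup X]
  (hψ : IsLocallyConstant (⇑ψ : R → Circle)) (hβ : ∀ y : Y, Continuous fun u : X => β u y)

/-- **(V3′) a common eigenvector of a torus family conjugated onto Siegel Levi elements**: if
`g₀ · π(p t) · g₀⁻¹ = m(a t, d t)` for all `t` and `f` is an eigenvector of every `op(p t)`, then for every `t`:
`∃ κ, ∀ x, (M₀ f)((a t)⁻¹ x) = κ · (M₀ f)(x)`.
[cite: MoeglinVignerasWaldspurger1987, Chap. 2 II.1 (A), II.6] [cite: Weil1964, n° 13, p. 160] -/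
theorem eigenvector_family_of_conj_levi (hU : ImplementerUniqueUpToScalar (schrodingerSB β ψ hψ hβ))
    (q : MpPsi (schrodingerSB β ψ hψ hβ)) {T : Type*} (p : T → MpPsi (schrodingerSB β ψ hψ hβ))
    (a : T → X ≃ₗ[R] X) (d : T → Y ≃ₗ[R] Y) (had : ∀ t x y, β (a t x) (d t y) = β x y)
    (ha : ∀ t, Continuous (a t)) (ha' : ∀ t, Continuous (a t).symm)
    (h : ∀ t : T, MpPsi.proj _ q * MpPsi.proj _ (p t) * (MpPsi.proj _ q)⁻¹ = leviSp β (a t) (d t) (had t))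
    (f : SchwartzBruhat X) (hf : ∀ t : T, ∃ κ : ℂ, MpPsi.toOp _ (p t) f = κ • f) (t : T) :
    ∃ κ : ℂ, ∀ x : X,
      ((MpPsi.toOp _ q f : SchwartzBruhat X) : X → ℂ) ((a t).symm x) =
        κ * ((MpPsi.toOp _ q f : SchwartzBruhat X) : X → ℂ) x := by
  obtain ⟨κ, hκ⟩ := hf t
  exact eigenvector_of_conj_levi_apply β ψ hψ hβ hU q (p t) (a t) (d t) (had t) (ha t) (ha' t) (h t) f κ hκ

end LeviFamily

end Literature.RepresentationTheory.HeisenbergGroup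

end
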